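import Literature.MathematicalPhysics.QuantumFieldTheory.Balaban1983to89.Node00.CarriersB8Sub
import Literature.MathematicalPhysics.QuantumFieldTheory.Balaban1983to89.B8SockHFPCubeMember

/-!
# `Balaban1983to89.B8CubeMemberIdxB8Laws` — [Balaban1985RegularSpaces] Sect. F, p. 98–99: THE CONCRETE CUBE MEMBER `{□_j}` OF (1.131)
# SATISFIES THE THREE LOCATED INDEX LAWS `Node00.IdxB8Laws` (№7 scale, №8 truncation, №11 graded cover) OF THE SUB-FAMILY OF RECORD —
# AND IS NOT A TERM OF `Node00.IdxB8 θ` (its `Ω₀` is the cube `□₀`, not `T_η`): the honest membership statement dag-lead's REBALANCE №53 (d)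
# asks for («the cube family's membership in `IdxB8′` as ONE lemma name»)

statement-level skeleton of published theorems with citation tags; proofs where landed; nothing here is a claim about the
Yang–Mills mass gap

T. Bałaban, *Spaces of regular gauge field configurations on a lattice and gauge fixing conditions*, Commun. Math. Phys. **99**
(1985) 75–102 `[Balaban1985RegularSpaces]` ("B8"), p. 77 («T_η, η = L^{−k}»; (1.3)–(1.6)), (1.19) p. 79, (1.34) p. 82, (1.68) p. 88,
p. 98 (construction of `□_j`), (1.131)–(1.132) p. 99.

CITATION HEADER (lean-in-tree rule).  Cell `pub-ymgap` (YM Track A, HUMAN RULING D-0062), DAG node N05 = [B8], seat `pub-ymgap-dag-n05-c`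
(g2; R134 fan-out).  WHY: the N05 junction flag J2 (ref-A g12 READ-6; dag-lead WORDS-103 ∕ REBALANCE №53): the letters-fed Prop.-5
providers (`B8SockHFPOfSockLetters.exists_threshold_sockHFP_pair`, n05-d) serve exactly the members of n05-a's index `B8LeafModelZd.ZdIdx`
obeying the located index laws — towers inside `Ω_j` at EVERY truncation (a theorem of №8, `Node00.IdxB8Laws.tower_all`) and the
truncation law №8 — so the knit is re-keyed over the sub-index of record `Node00.IdxB8Sub θ = {i : IdxB8 θ ∕∕ IdxB8Laws θ.L i.1}`
(node00-def g32, `Node00/CarriersB8Sub`).  REBALANCE №53 (d) asks this seat for «the cube family's membership in `IdxB8′` as ONE lemma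
name, so the K1-side instance is by name».  THIS FILE gives the honest form of that membership for the concrete cube member of
`B8CubeMemberZd` (`(Ω, Λs, Λb) := (cubeFam false, cubeLamS, cubeLamB)`, `exists_member_cube`):
* §1 **`idxB8Laws_cubeMember`** — the member satisfies `Node00.IdxB8Laws L` (№7 `scale` under the hypothesis `Lᵏη ≤ 1`, with equality at
  print's `η = L⁻ᵏ` (`idxB8Laws_cubeMember_of_eta`); №8 = `B8SockHFPCubeMember.h8lt_cubeLamS` ∕ `h8top_cubeLamS` BY NAME; №11 `cover` =
  `cover_cubeLamS`, from `B8CubeMemberZd.cubeLamS_cover`); packaged ∃-forms `exists_member_cube_laws` (every field pinned by an equation,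
  plus the laws) and `exists_member_cube_sub` (a term of the laws-cut index `{i : ZdIdx d L ∕∕ IdxB8Laws L i}`).
* §2 **`cubeFam_false_zero_ne_univ`** ∕ **`not_exists_idxB8_cubeMember`** — the kernel witness that the member is NOT a term of
  `Node00.IdxB8 θ = {i ∕∕ i.Ω 0 = univ}` (its `Ω₀ = □₀` is a bounded box, `1 ≤ D`), hence not of `IdxB8Sub θ`.
CONSEQUENCE (located, for the K1 side): a letters binder keyed on the laws-cut index `{i : ZdIdx ∕∕ IdxB8Laws L i}` WITHOUT the
`Ω₀ = univ` clause (n05-a g7's generic knit F4b at `ι := Subtype.val`; its Thm-4 ∕ Prop-3 conclusions do not read `Ω₀ = univ`) ranges over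
the cube members through §1; a binder keyed on `IdxB8Sub θ` does not (§2), and Prop. 6's sockets at the cube member then stay the separate
three of `B8SockHFPCubeMember.prop6_cubeMember_of_letters`.

WHY `Ω₀ = □₀` AND NOT `T_η` (recalled from `B8CubeMemberZd`, HONEST SCOPE (iii)): (1.132) reads `U₀″ ∈ 𝔄_k({□_j}, L³α₀)`, the (1.7)
class of the CUBE family; with `Ω₀ := T_η` (`cubeFam true`) the level-0 (1.7)-clause would be asked of `U₀″` on all of `T_η`, where `U₀″`
is only controlled on `□̃` — so the member feeding the concrete Theorem-4 driver is the one with `Ω₀ = □₀`.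

HONEST SCOPE.  Index-law bookkeeping on print's own cube family (two `rw` + the landed geometry lemmas BY NAME); nothing of Bałaban's
analysis is asserted or used; count-neutral; N05 NOT discharged; `T_η ↦ ℤᵈ` as in the whole N05 lineage; one finite `T⁴` programme at
fixed `ε`, Bałaban as printed — nothing continuum ∕ ℝ⁴ ∕ OS ∕ mass-gap ∕ Clay.  No `sorry`, no `axiom`, no `instance`, no `notation`.
Unit `pub-ymgap-dag-n05-c` (g2), 2026-08-26.
VERSION v1.1 (same seat, APPEND-ONLY §§3–4; referee flag J2′ = ref-A g12, dag-lead REBALANCE №55 (c)(e)): §3 **`exists_idxB8Sub_bonds_empty`** —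
the laws `IdxB8Laws` read `Ω`, `Λs`, `η`, `k` only, so the sub-index `IdxB8Sub θ` still contains members with EMPTY bond classes at every level
(the J2′ witness transfers inside the sub-index; the bond-set law of №55 (a) is load-bearing); §4 the cube member's bond classes `cubeLamB` ARE
the maximal class of the `ZdIdx` bond laws (`mem_cubeLamB_iff`, `subset_cubeLamB_of_laws`) and are NONEMPTY at every level `j ≤ m ≤ k` for
`d ≥ 2`, `ρ ≥ 1` (**`cubeLamB_nonempty`**, witness bond `⟨sqLo_j, sqLo_j + e₀⟩`; `bondBox_subset_cube_of_ends`, `sqLo_mem_cubeLamB`,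
`bonds_nonempty_cubeMember`).  §§1–2 unchanged.
VERSION v1.2 (same seat, APPEND-ONLY §5): **`mem_cubeLamB_iff_inner`** ∕ `cubeLamB_eq_inner` — at the cube member the crossing disjuncts of `hclass` are
inert under `hbox` (far end's block in `Λ_{j−1}` lies outside `□_j^{(j)}`, `smul_not_mem_cubeLam_pred`): `cubeLamB m j` = the INNER bonds of `cubeLamS m j` with
box in `□_j`.  §§1–4 unchanged.
-/

noncomputable section

namespace Literature.MathematicalPhysics.QuantumFieldTheory.Balaban1983to89.B8CubeMemberIdxB8Laws

open B7Prop1Explicit B7Prop1Local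
open B8Ineq130 (tlo thi)
open B8Ineq132 (Under)
open B8LeafModelZd (ZdIdx)
open B8Eq131Cubes (cube sqLo sqHi inLo inHi gs one_le_gs bLo bHi)
open B8Eq131CubesAdmissible (cubeFam cubeFam_false_of_le cubeFam_false_zero smul_mem_cube_iff)
open B8CubeMemberZd (cubeLamS cubeLamB cubeLamS_self cubeLamS_cover under_smul_iff inBox_tower_iff_under exists_member_cube)
open B8SockHFPCubeMember (h8lt_cubeLamS h8top_cubeLamS)
open Node00 (IdxB8Laws IdxB8 IdxB8Sub Stage3Params)

variable {d : ℕ}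

/-! ## §1 The three located index laws at the concrete cube member -/

/-- **№11 for `{□_j}` — (1.6) AT EVERY LEVEL `ℓ ≤ k`** (the `cover` field of `Node00.IdxB8Laws`, n05-a's `h16`): a level-`ℓ` site `w` whose
tower `B^ℓ(w)` lies in `Ω_ℓ = □_ℓ` has `Lˡ•w ∈ □_ℓ`, i.e. `w ∈ □_ℓ^{(ℓ)} = cubeLamS … ℓ ℓ` (`smul_mem_cube_iff`), and then lies under some
tower top `y ∈ Λ_j`, `ℓ ≤ j ≤ k` (`B8CubeMemberZd.cubeLamS_cover`, «Ω_ℓ^{(ℓ)} = ⋃_{j ≥ ℓ} B^{j−ℓ}(Λ_j)»).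
[cite: Balaban1985RegularSpaces, (1.6) p.77, (1.4) p.77, p.98 («□_j is a sum of the big blocks of the lattice T_{L^{−j}}»)] -/
theorem cover_cubeLamS {L : ℕ} (hL : 1 ≤ L) (a : B7Prop1Explicit.Site d) (M ρ k : ℕ) :
    ∀ ℓ, ℓ ≤ k → ∀ w : B7Prop1Explicit.Site d, (∀ x, InBox (tlo L w ℓ) (thi L w ℓ) x → x ∈ cubeFam false L a M ρ k ℓ) →
      ∃ j, ℓ ≤ j ∧ j ≤ k ∧ ∃ y ∈ cubeLamS L a M ρ k k j, Under L (j - ℓ) y w := by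
  intro ℓ hℓ w hw
  -- the block corner `Lˡ•w` lies in its own tower, hence in `□_ℓ`
  have h0 : Under L (0 + ℓ) w (((L : ℤ) ^ ℓ) • w) :=
    (under_smul_iff hL 0 ℓ w w).2 ((B8Eq131Derivation.under_zero_iff L w w).2 rfl)
  rw [Nat.zero_add] at h0
  have h1 : ((L : ℤ) ^ ℓ) • w ∈ cubeFam false L a M ρ k ℓ := hw _ ((inBox_tower_iff_under L ℓ w _).2 h0)
  rw [cubeFam_false_of_le L a M ρ hℓ, smul_mem_cube_iff hL a M ρ k ℓ w] at h1
  have hmem : w ∈ cubeLamS L a M ρ k ℓ ℓ := by rw [cubeLamS_self]; exact h1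
  exact cubeLamS_cover hL a M ρ k ℓ hℓ ℓ le_rfl w hmem

/-- **THE CONCRETE CUBE MEMBER SATISFIES THE THREE LOCATED INDEX LAWS `Node00.IdxB8Laws`** (REBALANCE №53 (d), honest form): for any
member `i` of n05-a's index with `i.Ω = cubeFam false …` (`Ω_j = □_j`, `Ω₀ = □₀`), `i.Λs = cubeLamS …` (print's truncations (1.68)) and
`i.k = k` — e.g. the member of `B8CubeMemberZd.exists_member_cube` — №8 (`trunc_lt`, `trunc_top`) is `B8SockHFPCubeMember.h8lt_cubeLamS` ∕
`h8top_cubeLamS` BY NAME, №11 (`cover`) is `cover_cubeLamS`, and №7 (`scale`, `Lᵏη ≤ 1`) is the displayed hypothesis `hscale` (print: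
`η = L⁻ᵏ`, p. 77). [cite: Balaban1985RegularSpaces, p.77 («T_η, η = L^{−k}»), (1.6) p.77, (1.19) p.79, (1.34) p.82, (1.68) p.88, (1.131) p.99] -/
theorem idxB8Laws_cubeMember {L : ℕ} (hL : 1 ≤ L) (a : B7Prop1Explicit.Site d) (M ρ k : ℕ) {i : ZdIdx d L} (hk : i.k = k)
    (hΩ : i.Ω = cubeFam false L a M ρ k) (hΛ : i.Λs = cubeLamS L a M ρ k) (hscale : (L : ℝ) ^ i.k * i.η ≤ 1) :
    IdxB8Laws L i where
  scale := hscale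
  trunc_lt m hm j hj := by
    rw [hk] at hm
    rw [hΛ]
    exact h8lt_cubeLamS L a M ρ k m hm j hj
  trunc_top m hm x := by
    rw [hk] at hm
    rw [hΛ]
    exact h8top_cubeLamS hL a M ρ k m hm x
  cover ℓ hℓ w hw := by
    rw [hk] at hℓ ⊢
    rw [hΩ] at hw
    rw [hΛ]
    exact cover_cubeLamS hL a M ρ k ℓ hℓ w hw

/-- **At print's spacing `η = L⁻ᵏ` the scale law №7 holds with equality**, so the cube member satisfies all three laws outright.
[cite: Balaban1985RegularSpaces, p.77 («T_η, η = L^{−k}»), (1.131) p.99] -/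
theorem idxB8Laws_cubeMember_of_eta {L : ℕ} (hL : 1 ≤ L) (a : B7Prop1Explicit.Site d) (M ρ k : ℕ) {i : ZdIdx d L} (hk : i.k = k)
    (hΩ : i.Ω = cubeFam false L a M ρ k) (hΛ : i.Λs = cubeLamS L a M ρ k) (hη : i.η = ((L : ℝ)⁻¹) ^ i.k) :
    IdxB8Laws L i :=
  idxB8Laws_cubeMember hL a M ρ k hk hΩ hΛ (by
    rw [hη, ← mul_pow, mul_inv_cancel₀ (by exact_mod_cast (show L ≠ 0 by omega)), one_pow])

/-- **THE CUBE FAMILY `{□_j}_{j=0}^{k}` IS A LAW-ABIDING MEMBER OF `ZdIdx d L`** (`B8CubeMemberZd.exists_member_cube` + §1): for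
`1 ≤ L ≤ R₁M₁`, `k ≥ 1`, `0 < η` with `Lᵏη ≤ 1` there is `i : ZdIdx d L` with every field pinned (`i.k = k`, `i.η = η`, `i.Ω = cubeFam false …`,
`i.Λs = cubeLamS …`, `i.Λb = cubeLamB …`) AND `IdxB8Laws L i`. [cite: Balaban1985RegularSpaces, (1.131) p.99, (1.3)–(1.6) p.77, (1.68) p.88, p.77 («η = L^{−k}»)] -/
theorem exists_member_cube_laws {L : ℕ} (hL : 1 ≤ L) (a : B7Prop1Explicit.Site d) (M : ℕ) {ρ : ℕ} (hρ : L ≤ ρ) {k : ℕ} (hk : 1 ≤ k) {η : ℝ}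
    (hη : 0 < η) (hscale : (L : ℝ) ^ k * η ≤ 1) :
    ∃ i : ZdIdx d L, i.k = k ∧ i.η = η ∧ i.Ω = cubeFam false L a M ρ k ∧ i.Λs = cubeLamS L a M ρ k ∧ i.Λb = cubeLamB L a M ρ k ∧
      IdxB8Laws L i := by
  obtain ⟨i, hik, hiη, hΩ, hΛ, hΛb⟩ := exists_member_cube hL a M hρ hk hη
  exact ⟨i, hik, hiη, hΩ, hΛ, hΛb, idxB8Laws_cubeMember hL a M ρ k hik hΩ hΛ (by rw [hik, hiη]; exact hscale)⟩

/-- **The cube family as a term of the laws-cut index `{i : ZdIdx d L ∕∕ IdxB8Laws L i}`** — the index a letters binder WITHOUT the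
`Ω₀ = univ` clause is keyed on (n05-a's generic knit at `ι := Subtype.val`); fields pinned as in `exists_member_cube`.
[cite: Balaban1985RegularSpaces, (1.131) p.99, (1.3)–(1.6) p.77, (1.68) p.88] -/
theorem exists_member_cube_sub {L : ℕ} (hL : 1 ≤ L) (a : B7Prop1Explicit.Site d) (M : ℕ) {ρ : ℕ} (hρ : L ≤ ρ) {k : ℕ} (hk : 1 ≤ k) {η : ℝ}
    (hη : 0 < η) (hscale : (L : ℝ) ^ k * η ≤ 1) :
    ∃ i : {i : ZdIdx d L // IdxB8Laws L i},
      i.1.k = k ∧ i.1.η = η ∧ i.1.Ω = cubeFam false L a M ρ k ∧ i.1.Λs = cubeLamS L a M ρ k ∧ i.1.Λb = cubeLamB L a M ρ k := by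
  obtain ⟨i, hik, hiη, hΩ, hΛ, hΛb, hlaws⟩ := exists_member_cube_laws (d := d) hL a M hρ hk hη hscale
  exact ⟨⟨i, hlaws⟩, hik, hiη, hΩ, hΛ, hΛb⟩

/-- **The tower law at every truncation for the cube member, read off the laws** (`Node00.IdxB8Laws.tower_all`, node00-def g32) — the
same statement `B8SockHFPCubeMember.htw_cubeLamS` proves directly; recorded so that both routes to n05-d's (L1) agree BY NAME at this member.
[cite: Balaban1985RegularSpaces, (1.5)–(1.6) p.77, (1.68) p.88] -/
theorem tower_all_cubeMember {L : ℕ} (hL : 1 ≤ L) (a : B7Prop1Explicit.Site d) (M ρ k : ℕ) {i : ZdIdx d L} (hk : i.k = k)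
    (hΩ : i.Ω = cubeFam false L a M ρ k) (hΛ : i.Λs = cubeLamS L a M ρ k) (hscale : (L : ℝ) ^ i.k * i.η ≤ 1) :
    ∀ m, m ≤ k → ∀ j, j ≤ m → ∀ y ∈ cubeLamS L a M ρ k m j, ∀ x, InBox (tlo L y j) (thi L y j) x → x ∈ cubeFam false L a M ρ k j := by
  have h := (idxB8Laws_cubeMember hL a M ρ k hk hΩ hΛ hscale).tower_all
  rw [hk, hΩ, hΛ] at h
  exact h

/-! ## §2 The cube member is NOT a term of `Node00.IdxB8 θ` (its `Ω₀` is `□₀`, not `T_η`) -/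

/-- **`Ω₀ = □₀ ≠ T_η`** for the cube family with `top := false` (`1 ≤ d`): the level-0 cube `□₀ = [Lᵏ·sqLo, Lᵏ·sqHi + Lᵏ − 1]ᵈ`-box is
bounded, so the site one step above its upper corner is outside. [cite: Balaban1985RegularSpaces, p.98 («□₀, □₁, …, □_k»), (1.132) p.99] -/
theorem cubeFam_false_zero_ne_univ (hd : 1 ≤ d) (L : ℕ) (a : B7Prop1Explicit.Site d) (M ρ k : ℕ) : cubeFam false L a M ρ k 0 ≠ Set.univ := by
  intro h
  have hx : (fun i => thi L (sqHi L a M ρ k 0) 0 i + 1) ∈ cubeFam false L a M ρ k 0 := by rw [h]; exact Set.mem_univ _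
  rw [cubeFam_false_zero] at hx
  have h2 := (hx ⟨0, hd⟩).2
  simp only at h2
  linarith

/-- **THE CUBE MEMBER IS NOT A TERM OF `Node00.IdxB8 θ = {i ∕∕ i.Ω 0 = univ}`** (hence not of `IdxB8Sub θ`): no member of g31's full index
has the cube family (`top := false`) as its domain sequence (`θ.D = d₆ + 1 ≥ 1`).  So a socket binder keyed on `IdxB8Sub θ` does not range
over the cube members; the laws-cut index of §1 (`exists_member_cube_sub`) is the one that does.
[cite: Balaban1985RegularSpaces, p.77 («we admit the case where some domains Ω_j are equal to T_η»), p.98, (1.132) p.99] -/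
theorem not_exists_idxB8_cubeMember (θ : Stage3Params) (a : B7Prop1Explicit.Site θ.D) (M ρ k : ℕ) :
    ¬ ∃ i : IdxB8 θ, i.1.Ω = cubeFam false θ.L a M ρ k := by
  rintro ⟨i, hi⟩
  have h0 : cubeFam false θ.L a M ρ k 0 = Set.univ := by rw [← hi]; exact i.2
  exact cubeFam_false_zero_ne_univ (by have := θ.hd₆; omega) θ.L a M ρ k h0

/-- The same for the sub-index of record `IdxB8Sub θ`. [cite: Balaban1985RegularSpaces, p.77, p.98, (1.132) p.99] -/
theorem not_exists_idxB8Sub_cubeMember (θ : Stage3Params) (a : B7Prop1Explicit.Site θ.D) (M ρ k : ℕ) :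
    ¬ ∃ i : IdxB8Sub θ, i.1.1.Ω = cubeFam false θ.L a M ρ k := by
  rintro ⟨i, hi⟩
  exact not_exists_idxB8_cubeMember θ a M ρ k ⟨i.1, hi⟩

/-! ## §3 (v1.1) The laws do not read the bond classes: an EMPTY-BOND member of `IdxB8Sub θ` (referee flag J2′ inside the sub-index)

dag-lead REBALANCE №55 (e) asked: does ref-A's J2′ witness (k = 2, `Ω ≡ univ`, `Λs 2 0 = univ`, every other `Λs m j = ∅`, `Λb ≡ ∅`) satisfy
`IdxB8Laws`?  THAT member does not (№8 `trunc_lt` fails at `(m, j) = (1, 0)`, №11 `cover` fails at `ℓ = 1, 2`).  But the laws constrain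
`Ω`, `Λs`, `η`, `k` only: n05-a's non-vacuity geometry (`Ω ≡ univ`, `Λs m j = univ` iff `j = m`, `η = L⁻ᵏ`; g32's `idxB8Laws_of_member_univ`)
with its bond classes REPLACED by `∅` (legal in `ZdIdx`: `hbox`∕`hclass` are vacuous, `htower`∕`hpart` unchanged) is a term of `IdxB8Sub θ` at
every depth — so any b9-socket binder `∀ i : IdxB8Sub θ, ∀ m ≤ k, SockB9P3 … (i.Λb m)` meets ref-A's empty-bond-subtype witness INSIDE the
sub-index, and the bond-set law of REBALANCE №55 (a) is load-bearing. -/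

/-- **AN EMPTY-BOND MEMBER OF THE SUB-INDEX OF RECORD AT EVERY DEPTH `k ≥ 1`** (J2′ inside `IdxB8Sub`): `Ω_j = ℤᵈ`, `Λs m j = ℤᵈ` iff `j = m`,
`η = L⁻ᵏ`, and `Λb m j = ∅` for all `m, j` — the three located laws hold (g32's `idxB8Laws_of_member_univ`), the `ZdIdx` bond-class laws are
vacuous.  Kernel witness that `Node00.IdxB8Laws` carries NO bond-set clause. [cite: Balaban1985RegularSpaces, p.77 («we admit Ω_j = T_η»), (1.31) p.82, p.86 (𝔅_k) (bookkeeping: a typing witness, nothing of the paper asserted)] -/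
theorem exists_idxB8Sub_bonds_empty (θ : Stage3Params) {k : ℕ} (hk : 1 ≤ k) :
    ∃ i : IdxB8Sub θ, i.1.1.k = k ∧ (∀ j, i.1.1.Ω j = Set.univ) ∧ (∀ m j, i.1.1.Λs m j = {_y | j = m}) ∧ ∀ m j, i.1.1.Λb m j = ∅ := by
  classical
  have hL : 1 ≤ θ.L := le_trans (by norm_num) θ.two_le_L
  have hη : (0 : ℝ) < ((θ.L : ℝ)⁻¹) ^ k := pow_pos (inv_pos.mpr (by exact_mod_cast (show 0 < θ.L by omega))) k
  let i : ZdIdx θ.D θ.L :=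
    ⟨((θ.L : ℝ)⁻¹) ^ k, hη, k, hk, fun _ => Set.univ, fun _ => le_rfl, fun m j => {_y | j = m}, fun _ _ => ∅,
      fun _ _ _ _ _ hc => absurd hc (Set.notMem_empty _), fun _ _ _ _ _ hc => absurd hc (Set.notMem_empty _),
      fun _ _ _ _ _ _ => Set.mem_univ _,
      fun x _ => ⟨k, le_rfl, B8Eq131Cubes.flm θ.L k x, rfl, (inBox_tower_iff_under θ.L k _ x).2 (B8Eq131Cubes.under_flm hL k x)⟩⟩
  exact ⟨⟨⟨i, rfl⟩, Node00.idxB8Laws_of_member_univ hL rfl (fun _ _ => rfl)⟩, rfl, fun _ => rfl, fun _ _ => rfl, fun _ _ => rfl⟩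

/-! ## §4 (v1.1) The cube member's bond classes are STATED and NONEMPTY at every level (dag-lead REBALANCE №55 (c))

`B8CubeMemberZd.cubeLamB L a M ρ k m j` is, BY DEFINITION, the MAXIMAL class the `ZdIdx` laws `hbox`∕`hclass` admit for `(Ω, Λs) := (cubeFam false,
cubeLamS)`: every level-`j` bond whose box `Bʲ(c₋) ∪ Bʲ(c₊)` lies in `□_j` and which is INNER (both ends in `cubeLamS m j`) or CROSSING (one end in
`cubeLamS m j`, the block under the other in `cubeLamS m (j−1)`) — «𝔅 generated by the Λ-tower» in the maximal reading (`mem_cubeLamB_iff`,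
`subset_cubeLamB_of_laws`).  It is NONEMPTY at every `(m, j)`, `j ≤ m ≤ k`, for `d ≥ 2`, `ρ ≥ 1`: the inner bond `⟨sqLo_j, sqLo_j + e₀⟩` at the lower
corner of `□_j^{(j)}` (in `Λ_j`: the margin to `□_{j+1}^{(j)}` is `ρ ≥ 1` and `d ≥ 2` keeps the second coordinate on the face; the side is ≥ 2 since
`2ρ·gs ≥ 2`) — so the cube member has NO level with nonempty `Λs` and empty `Λb` (no located defect for cube ∕ n05-e). -/

/-- **The cube member's bond class is the maximal class of the laws** (`Iff.rfl` on `B8CubeMemberZd.cubeLamB`): a bond `c` of level `j` belongs to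
`cubeLamB … m j` iff its box lies in `□_j` and it is inner or crossing w.r.t. the truncation `cubeLamS … m`.
[cite: Balaban1985RegularSpaces, (1.31) p.82, (1.37) p.82, (1.42) p.83, p.86 (𝔅_k), (1.131) p.99] -/
theorem mem_cubeLamB_iff (L : ℕ) (a : B7Prop1Explicit.Site d) (M ρ k m j : ℕ) (c : B7Prop1Explicit.Site d × Fin d) :
    c ∈ cubeLamB L a M ρ k m j ↔
      (∀ x, InBox (loK L j c.1) (bondHiK L j c.1 c.2) x → x ∈ cubeFam false L a M ρ k j) ∧
        ((c.1 ∈ cubeLamS L a M ρ k m j ∧ c.1 + e c.2 ∈ cubeLamS L a M ρ k m j) ∨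
          (∃ j', j = j' + 1 ∧ (∀ x, (L : ℤ) • c.1 ≤ x → x ≤ (L : ℤ) • c.1 + B8Thm2LogB.blockTop L → x ∈ cubeLamS L a M ρ k m j') ∧
            c.1 + e c.2 ∈ cubeLamS L a M ρ k m j) ∨
          (∃ j', j = j' + 1 ∧ c.1 ∈ cubeLamS L a M ρ k m j ∧
            (∀ x, (L : ℤ) • (c.1 + e c.2) ≤ x → x ≤ (L : ℤ) • (c.1 + e c.2) + B8Thm2LogB.blockTop L → x ∈ cubeLamS L a M ρ k m j'))) :=
  Iff.rfl

/-- **Maximality**: any bond class `Λb′` obeying the two `ZdIdx` bond laws (`hbox`: box inside `□_j`; `hclass`: inner-or-crossing w.r.t. `cubeLamS`)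
is contained in `cubeLamB` — the cube member's `Λb` IS «all bonds the Λ-tower determines». [cite: Balaban1985RegularSpaces, (1.31) p.82, p.86 (𝔅_k)] -/
theorem subset_cubeLamB_of_laws (L : ℕ) (a : B7Prop1Explicit.Site d) (M ρ k : ℕ) {Λb' : ℕ → ℕ → Set (B7Prop1Explicit.Site d × Fin d)}
    (hbox : ∀ m, m ≤ k → ∀ j, j ≤ m → ∀ c ∈ Λb' m j, ∀ x, InBox (loK L j c.1) (bondHiK L j c.1 c.2) x → x ∈ cubeFam false L a M ρ k j)
    (hclass : ∀ m, m ≤ k → ∀ j, j ≤ m → ∀ c ∈ Λb' m j,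
      (c.1 ∈ cubeLamS L a M ρ k m j ∧ c.1 + e c.2 ∈ cubeLamS L a M ρ k m j) ∨
      (∃ j', j = j' + 1 ∧ (∀ x, (L : ℤ) • c.1 ≤ x → x ≤ (L : ℤ) • c.1 + B8Thm2LogB.blockTop L → x ∈ cubeLamS L a M ρ k m j') ∧
        c.1 + e c.2 ∈ cubeLamS L a M ρ k m j) ∨
      (∃ j', j = j' + 1 ∧ c.1 ∈ cubeLamS L a M ρ k m j ∧
        (∀ x, (L : ℤ) • (c.1 + e c.2) ≤ x → x ≤ (L : ℤ) • (c.1 + e c.2) + B8Thm2LogB.blockTop L → x ∈ cubeLamS L a M ρ k m j'))) :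
    ∀ m, m ≤ k → ∀ j, j ≤ m → Λb' m j ⊆ cubeLamB L a M ρ k m j :=
  fun m hm j hj _ hc => ⟨hbox m hm j hj _ hc, hclass m hm j hj _ hc⟩

/-- **A bond with both ends in `□_j^{(j)}` has its box `Bʲ(c₋) ∪ Bʲ(c₊)` inside `□_j = Bʲ(□_j^{(j)})`** (lower end `≥ sqLo_j`, upper end `≤ sqHi_j`
componentwise). [cite: Balaban1985RegularSpaces, p.98 («□_j is a sum of the big blocks of the lattice T_{L^{−j}}»); Balaban1985Averaging, p.24 (locality box of (43))] -/
theorem bondBox_subset_cube_of_ends {L : ℕ} (hL : 1 ≤ L) (a : B7Prop1Explicit.Site d) (M ρ k j : ℕ) {z : B7Prop1Explicit.Site d}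
    {μ : Fin d} (hz : sqLo L a ρ k j ≤ z) (hz' : z + e μ ≤ sqHi L a M ρ k j) :
    ∀ x, InBox (loK L j z) (bondHiK L j z μ) x → x ∈ cube L a M ρ k j := by
  intro x hx i
  obtain ⟨h1, h2⟩ := hx i
  have hLj : (0 : ℤ) < (L : ℤ) ^ j := by positivity
  have hzi : sqLo L a ρ k j i ≤ z i := hz i
  have hz'i : z i + e μ i ≤ sqHi L a M ρ k j i := hz' i
  simp only [loK, bondHiK] at h1 h2
  rw [B8Ineq130.tlo_apply, B8Ineq130.thi_apply]
  have h3 : (L : ℤ) ^ j * sqLo L a ρ k j i ≤ (L : ℤ) ^ j * z i := mul_le_mul_of_nonneg_left hzi hLj.le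
  have h4 : (L : ℤ) ^ j * (z i + e μ i) ≤ (L : ℤ) ^ j * sqHi L a M ρ k j i := mul_le_mul_of_nonneg_left hz'i hLj.le
  by_cases hi : i = μ
  · subst hi
    simp only [e, Pi.single_eq_same, if_true] at h2 h4
    constructor <;> nlinarith
  · have he : e μ i = 0 := by simp [e, hi]
    rw [he, add_zero] at h4
    simp only [hi, if_false, add_zero] at h2
    constructor <;> nlinarith

/-- **The witness bond `⟨sqLo_j, sqLo_j + e₀⟩` belongs to the cube member's class `cubeLamB … m j` for every `j ≤ m ≤ k`** (`d ≥ 2`, `L ≥ 1`,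
`ρ ≥ 1`): both ends lie in `□_j^{(j)}` (side ≥ 2) and, for `j < k`, outside `□_{j+1}^{(j)}` (margin `ρ ≥ 1`; the second coordinate stays on
the lower face), i.e. in `Λ_j ⊂ cubeLamS m j`; the box clause by `bondBox_subset_cube_of_ends`. [cite: Balaban1985RegularSpaces, (1.131) p.99, p.98, (1.31) p.82] -/
theorem sqLo_mem_cubeLamB (hd2 : 2 ≤ d) {L : ℕ} (hL : 1 ≤ L) (a : B7Prop1Explicit.Site d) (M : ℕ) {ρ : ℕ} (hρ : 1 ≤ ρ) (k : ℕ)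
    {m j : ℕ} (hm : m ≤ k) (hj : j ≤ m) :
    (sqLo L a ρ k j, (⟨0, by omega⟩ : Fin d)) ∈ cubeLamB L a M ρ k m j := by
  have hjk : j ≤ k := hj.trans hm
  have hgs : 1 ≤ gs L (k - j) := one_le_gs L (k - j)
  have hρgs : (1 : ℤ) ≤ (ρ : ℤ) * (gs L (k - j) : ℤ) := by
    have h1 : (1 : ℤ) ≤ ρ := by exact_mod_cast hρ
    have h2 : (1 : ℤ) ≤ gs L (k - j) := by exact_mod_cast hgs
    nlinarith
  have hLM : (0 : ℤ) ≤ (L : ℤ) ^ (k - j) * (M : ℤ) := by positivity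
  -- coordinates of the corners
  have hlo : ∀ i, sqLo L a ρ k j i = (L : ℤ) ^ (k - j) * a i - (ρ : ℤ) * (gs L (k - j) : ℤ) := by
    intro i; simp [sqLo, bLo]
  have hhi : ∀ i, sqHi L a M ρ k j i = (L : ℤ) ^ (k - j) * (a i + M) - 1 + (ρ : ℤ) * (gs L (k - j) : ℤ) := by
    intro i; simp [sqHi, bHi]
  have hin : ∀ i, inLo L a ρ k j i = (L : ℤ) ^ (k - j) * a i - (ρ : ℤ) * ((gs L (k - j) : ℤ) - 1) := by
    intro i; simp [inLo, bLo, Nat.cast_sub hgs]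
  have he0 : ∀ i : Fin d, e (⟨0, by omega⟩ : Fin d) i = if i = ⟨0, by omega⟩ then 1 else 0 := by
    intro i; simp [e, Pi.single_apply]
  -- both ends in `□_j^{(j)}`
  have hz : InBox (sqLo L a ρ k j) (sqHi L a M ρ k j) (sqLo L a ρ k j) := by
    intro i; refine ⟨le_rfl, ?_⟩; rw [hlo, hhi]; nlinarith
  have hz' : InBox (sqLo L a ρ k j) (sqHi L a M ρ k j) (sqLo L a ρ k j + e ⟨0, by omega⟩) := by
    intro i
    simp only [Pi.add_apply, he0]
    split_ifs
    · refine ⟨by linarith, ?_⟩; rw [hlo, hhi]; nlinarith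
    · refine ⟨by linarith, ?_⟩; rw [add_zero, hlo, hhi]; nlinarith
  -- both ends outside `□_{j+1}^{(j)}` (read on the coordinate `1`, available since `d ≥ 2`)
  have hρpos : (0 : ℤ) < ρ := by exact_mod_cast hρ
  have hnot : ¬ InBox (inLo L a ρ k j) (inHi L a M ρ k j) (sqLo L a ρ k j) := by
    intro h
    have h1 := (h ⟨1, by omega⟩).1
    rw [hin, hlo] at h1
    nlinarith
  have hnot' : ¬ InBox (inLo L a ρ k j) (inHi L a M ρ k j) (sqLo L a ρ k j + e ⟨0, by omega⟩) := by
    intro h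
    have h1 := (h ⟨1, by omega⟩).1
    have hne : (⟨1, by omega⟩ : Fin d) ≠ ⟨0, by omega⟩ := by simp
    simp only [Pi.add_apply, he0, if_neg hne, add_zero] at h1
    rw [hin, hlo] at h1
    nlinarith
  -- membership of both ends in the truncation `cubeLamS m j`
  have hmem : ∀ z, InBox (sqLo L a ρ k j) (sqHi L a M ρ k j) z → ¬ InBox (inLo L a ρ k j) (inHi L a M ρ k j) z →
      z ∈ cubeLamS L a M ρ k m j := by
    intro z h1 h2
    rcases Nat.lt_or_ge j m with hjm | hjm
    · rw [B8CubeMemberZd.cubeLamS_of_lt L a M ρ k hjm]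
      exact ⟨h1, fun _ => h2⟩
    · obtain rfl : j = m := le_antisymm hj hjm
      rw [cubeLamS_self]
      exact h1
  refine ⟨fun x hx => ?_, Or.inl ⟨hmem _ hz hnot, hmem _ hz' hnot'⟩⟩
  rw [cubeFam_false_of_le L a M ρ hjk]
  exact bondBox_subset_cube_of_ends hL a M ρ k j (fun i => (hz i).1) (fun i => (hz' i).2) x hx

/-- **THE CUBE MEMBER'S BOND CLASSES ARE NONEMPTY AT EVERY LEVEL** `j ≤ m ≤ k` (`d ≥ 2`, `L ≥ 1`, `ρ = R₁M₁ ≥ 1`) — REBALANCE №55 (c): no level with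
nonempty `Λs` and empty `Λb`; the J2′ witness does not enter the cube member. [cite: Balaban1985RegularSpaces, (1.131) p.99, (1.31) p.82, p.86 (𝔅_k)] -/
theorem cubeLamB_nonempty (hd2 : 2 ≤ d) {L : ℕ} (hL : 1 ≤ L) (a : B7Prop1Explicit.Site d) (M : ℕ) {ρ : ℕ} (hρ : 1 ≤ ρ) (k : ℕ) :
    ∀ m, m ≤ k → ∀ j, j ≤ m → (cubeLamB L a M ρ k m j).Nonempty :=
  fun _ hm _ hj => ⟨_, sqLo_mem_cubeLamB hd2 hL a M hρ k hm hj⟩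

/-- The same read at a member of `ZdIdx d L` pinned to the cube family (`exists_member_cube`): `i.Λb m j ≠ ∅` for `j ≤ m ≤ i.k`.
[cite: Balaban1985RegularSpaces, (1.131) p.99, (1.31) p.82] -/
theorem bonds_nonempty_cubeMember (hd2 : 2 ≤ d) {L : ℕ} (hL : 1 ≤ L) (a : B7Prop1Explicit.Site d) (M : ℕ) {ρ : ℕ} (hρ : 1 ≤ ρ)
    {k : ℕ} {i : ZdIdx d L} (hk : i.k = k) (hΛb : i.Λb = cubeLamB L a M ρ k) :
    ∀ m, m ≤ i.k → ∀ j, j ≤ m → (i.Λb m j).Nonempty := by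
  rw [hk, hΛb]
  exact cubeLamB_nonempty hd2 hL a M hρ k


/-! ## §5 (v1.2) At the cube member the bond class consists of INNER bonds only (the crossing disjuncts of `hclass` are inert under `hbox`)

`ZdIdx.hbox` puts the whole bond box `Bʲ(c₋) ∪ Bʲ(c₊)` inside `Ω_j = □_j`, i.e. BOTH ends in `□_j^{(j)}`; a crossing disjunct of `hclass` puts the
block under one end inside `cubeLamS m (j−1) = Λ_{j−1} = □_{j−1}^{(j−1)} ∖ □_j^{(j−1)}`, i.e. that end OUTSIDE `□_j^{(j)}` (`B8Eq131Cubes.inner_eq_blowup`)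
— jointly impossible.  So `cubeLamB … m j` = {inner bonds of `cubeLamS m j` with box in `□_j`}: print's crossing bonds of (1.31)₂∕(1.37) («b₋ with
Γ_{b₋,x} ⊂ Λ_{j−1}, b₊ ∈ Λ_j», far end outside `Ω_j^{(j)}`) are not terms of n05-a's index at this member (recorded for the desk rows reading (1.37)
`C137` and the (1.59) socket's `|B₁|`-term over `Λb`; a property of the index as typed, not of law №12). -/

/-- A level-`j` site of `□_j^{(j)}` has its `L`-block inside `□_j^{(j−1)} = B(□_j^{(j)})` — in particular the block corner `L•z` lies in the
INNER box of level `j − 1` (`inner_eq_blowup`), hence NOT in `Λ_{j−1} = cubeLam (j−1)`. [cite: Balaban1985RegularSpaces, (1.5) p.77, (1.131) p.99, p.98] -/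
theorem smul_not_mem_cubeLam_pred {L : ℕ} (hL : 1 ≤ L) (a : B7Prop1Explicit.Site d) (M ρ : ℕ) {k j : ℕ} (hj1 : 1 ≤ j) (hjk : j ≤ k)
    {z : B7Prop1Explicit.Site d} (hz : InBox (sqLo L a ρ k j) (sqHi L a M ρ k j) z) :
    ((L : ℤ) • z) ∉ B8CubeMemberZd.cubeLam L a M ρ k (j - 1) := by
  obtain ⟨n, rfl⟩ : ∃ n, j = n + 1 := ⟨j - 1, by omega⟩
  rw [Nat.add_sub_cancel]
  obtain ⟨hlo, hhi⟩ := B8Eq131Cubes.inner_eq_blowup (L := L) a M ρ (show n < k by omega)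
  intro h
  have hin : InBox (inLo L a ρ k n) (inHi L a M ρ k n) ((L : ℤ) • z) := by
    rw [hlo, hhi]
    intro i
    obtain ⟨h1, h2⟩ := hz i
    have hL0 : (0 : ℤ) ≤ (L : ℤ) := by exact_mod_cast (Nat.zero_le L)
    have hL1 : (1 : ℤ) ≤ (L : ℤ) := by exact_mod_cast hL
    rw [B8Ineq130.tlo_apply, B8Ineq130.thi_apply]
    simp only [Pi.smul_apply, smul_eq_mul, pow_one]
    constructor <;> nlinarith
  exact (h.2 (by omega)) hin

/-- **AT THE CUBE MEMBER A CONSTRAINT BOND IS AN INNER BOND**: `c ∈ cubeLamB … m j` (`j ≤ m ≤ k`) iff its box lies in `□_j` and BOTH ends lie in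
`cubeLamS m j` — the two crossing disjuncts of `hclass` cannot fire (the far end's block would lie in `Λ_{j−1}`, outside `□_j^{(j)}`, against `hbox`).
[cite: Balaban1985RegularSpaces, (1.31) p.82, (1.37) p.82, (1.5) p.77, (1.131) p.99] -/
theorem mem_cubeLamB_iff_inner {L : ℕ} (hL : 1 ≤ L) (a : B7Prop1Explicit.Site d) (M ρ : ℕ) {k m j : ℕ} (hm : m ≤ k) (hj : j ≤ m)
    (c : B7Prop1Explicit.Site d × Fin d) :
    c ∈ cubeLamB L a M ρ k m j ↔
      (∀ x, InBox (loK L j c.1) (bondHiK L j c.1 c.2) x → x ∈ cubeFam false L a M ρ k j) ∧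
        c.1 ∈ cubeLamS L a M ρ k m j ∧ c.1 + e c.2 ∈ cubeLamS L a M ρ k m j := by
  have hjk : j ≤ k := hj.trans hm
  refine ⟨fun hc => ?_, fun h => ⟨h.1, Or.inl h.2⟩⟩
  obtain ⟨hbox, hcl⟩ := hc
  refine ⟨hbox, ?_⟩
  -- both ends lie in `□_j^{(j)}` by `hbox`
  have hbox' : ∀ x, InBox (loK L j c.1) (bondHiK L j c.1 c.2) x → x ∈ cube L a M ρ k j := by
    intro x hx; have := hbox x hx; rwa [cubeFam_false_of_le L a M ρ hjk] at this
  have h1 : InBox (sqLo L a ρ k j) (sqHi L a M ρ k j) c.1 :=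
    (smul_mem_cube_iff hL a M ρ k j c.1).1 (hbox' _ (B8CubeMemberZd.smul_mem_bondBox hL j c.1 c.2))
  have h2 : InBox (sqLo L a ρ k j) (sqHi L a M ρ k j) (c.1 + e c.2) :=
    (smul_mem_cube_iff hL a M ρ k j (c.1 + e c.2)).1 (hbox' _ (B8CubeMemberZd.smul_add_mem_bondBox hL j c.1 c.2))
  -- the block corner of an end lies in its own `L`-block
  have hcorner : ∀ z : B7Prop1Explicit.Site d, (L : ℤ) • z ≤ (L : ℤ) • z ∧ (L : ℤ) • z ≤ (L : ℤ) • z + B8Thm2LogB.blockTop L := by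
    intro z
    refine ⟨le_rfl, fun i => ?_⟩
    have hL1 : (1 : ℤ) ≤ (L : ℤ) := by exact_mod_cast hL
    simp only [Pi.add_apply, B8Thm2LogB.blockTop]
    linarith
  rcases hcl with h | ⟨j', hjj', hblk, hend⟩ | ⟨j', hjj', hend, hblk⟩
  · exact h
  · -- crossing₁: the block under `c₋` would lie in `Λ_{j−1}` — impossible
    exfalso
    have hmem := hblk ((L : ℤ) • c.1) (hcorner c.1).1 (hcorner c.1).2
    rw [B8CubeMemberZd.cubeLamS_of_lt L a M ρ k (show j' < m by omega)] at hmem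
    have := smul_not_mem_cubeLam_pred hL a M ρ (show 1 ≤ j by omega) hjk h1
    rw [show j - 1 = j' by omega] at this
    exact this hmem
  · -- crossing₂: the block under `c₊` would lie in `Λ_{j−1}` — impossible
    exfalso
    have hmem := hblk ((L : ℤ) • (c.1 + e c.2)) (hcorner _).1 (hcorner _).2
    rw [B8CubeMemberZd.cubeLamS_of_lt L a M ρ k (show j' < m by omega)] at hmem
    have := smul_not_mem_cubeLam_pred hL a M ρ (show 1 ≤ j by omega) hjk h2
    rw [show j - 1 = j' by omega] at this
    exact this hmem

/-- **The cube member's bond class `= {inner bonds with box in □_j}`** (set form of `mem_cubeLamB_iff_inner`). [cite: Balaban1985RegularSpaces, (1.31) p.82, (1.131) p.99] -/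
theorem cubeLamB_eq_inner {L : ℕ} (hL : 1 ≤ L) (a : B7Prop1Explicit.Site d) (M ρ : ℕ) {k m j : ℕ} (hm : m ≤ k) (hj : j ≤ m) :
    cubeLamB L a M ρ k m j =
      {c | (∀ x, InBox (loK L j c.1) (bondHiK L j c.1 c.2) x → x ∈ cubeFam false L a M ρ k j) ∧
        c.1 ∈ cubeLamS L a M ρ k m j ∧ c.1 + e c.2 ∈ cubeLamS L a M ρ k m j} := by
  ext c
  exact mem_cubeLamB_iff_inner hL a M ρ hm hj c

end Literature.MathematicalPhysics.QuantumFieldTheory.Balaban1983to89.B8CubeMemberIdxB8Laws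

end
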